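import Literature.LinearAlgebra.RootSystem.AffineWeylGroupOmegaDiagram
import Literature.LinearAlgebra.RootSystem.AffineWeylGroupReflections
import Mathlib.LinearAlgebra.RootSystem.Irreducible
import HarnessLib

/-!
# The linear part of `Ω`: it is faithful and permutes `{α_1, …, α_l, -α₀}` like the nodes (Iwahori–Matsumoto 1965 §1.8, Prop. 1.21 (ii))

N. Iwahori, H. Matsumoto, *On some Bruhat decomposition and the structure of the Hecke rings of p-adic Chevalley groups*, Publ. Math. IHÉS 25
(1965) [IwahoriMatsumoto1965] (held `paper:doi-10-1007-bf02684396`, p0014 = p. 248), §1.8: «We shall now consider the automorphism `σ ↦ ρσρ⁻¹` of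
`D'W` defined by `ρ ∈ Ω`. Since `λ(ρσρ⁻¹) = λ(σ)`, this automorphism induces a permutation of the set `{w₀, w₁, …, w_l}`. Thus we get a homomorphism
from `Ω` onto a permutation group of `l + 1` letters `w₀, w₁, …, w_l`. This homomorphism is injective. … **Proposition 1.21.** (i) Let `ρ = T(ε_i)
w_{Π_i} w_Π ∈ Ω` with `(α₀, ε_i) = 1`. Then `ρ w₀ ρ⁻¹ = w_i`. (ii) Let `φ : DW → W` be the natural homomorphism. Then `φ` is injective on `Ω` and
the set `{α₁, …, α_l, -α₀}` is stable under the subgroup `W_Ω = φ(Ω)` of `W`.» (Here `w₀ = w_{α₀,1}`, `w_i = w_{α_i}`, `α₀` the highest root, `DW`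
the extended affine Weyl group, `Ω = {ρ ∈ DW ; ρ𝔇∘ = 𝔇∘}`.)  N. Bourbaki, *Lie Groups and Lie Algebras, Ch. 4–6* [Bourbaki2002LieGroups46], Ch. VI
§2 no. 3 (cite-only): the group of automorphisms of the alcove and of the completed Dynkin graph.  J. E. Humphreys, *Reflection Groups and Coxeter
Groups* (1990) [Humphreys1990], §4.5 (p. 93): «`Ω ≅ Ŵ_a ∕ W_a ≅ L̂ ∕ L` … this finite abelian group».

THIS FILE (lane `lit-hodgefound`, prover seat p40, generation 46, row g46-#6; THEOREMS ONLY — no definition, instance, notation or named fact; net debt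
0). CONVENTION of the `AffineWeylGroup*` files: weight space `M`, `Ŵ_a = T_{P(Φ)} ⋊ W ≤ Aff(M)`, an element of `Ω` is an `o ∈ Ŵ_a` with `oA∘ = A∘`,
written `o = t(v)·g` (`v = o(0) ∈ P(Φ)`, `g ∈ W` = ITS LINEAR PART `φ(o)`, row g44-#1 `exists_of_mem_extendedAffineWeylGroup`); the nodes of the
extended Dynkin diagram are `Option Δ` (`none` = the new node, wall `H_{α_η,1}`; `some j` = `H_{α_j}`), `σ_o` is the node permutation `o s_x o⁻¹ =
s_{σ_o x}` (row g45-#5); IM's set `{α₁, …, α_l, -α₀}` is, on indices, `Δ ∪ {-η}` with `-η = s_η η` (`P.reflectionPerm η η`) the index of `-α_η`.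

* §1 ★★ **`floorData_smul_add_eq`** — the bookkeeping identity of an element of `Ω`: `k∘_α + ⟨v, (gα)^∨⟩ = k∘_{gα}` for every root `α` (`o·A∘ = A∘` in
  floor data, row g44-#6).
* §2 PROPOSITION 1.21 (ii), SECOND HALF — `φ(Ω)` PERMUTES `{α₁, …, α_l, -α₀}` EXACTLY AS `σ_o` PERMUTES THE NODES: ★★★ **`smul_eq_of_perm_some_eq_some`**
  (`σ_o(j) = k ⟹ gα_j = α_k`), ★★★ **`smul_eq_of_perm_some_eq_none`** (`σ_o(j) = 0 ⟹ gα_j = -α_η`), ★★★ **`smul_eq_of_perm_none_eq_some`** (`σ_o(0) = k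
  ⟹ g(-α_η) = α_k`), ★★ **`smul_eq_of_perm_none_eq_none`** (`σ_o(0) = 0 ⟹ gα_η = α_η`); ★★ **`smul_mem_of_mem_support`** ∕ **`smul_reflectionPerm_mem`**
  («the set `{α₁, …, α_l, -α₀}` is stable under `φ(Ω)`»). The proofs compare the two names (row g46-#1 `affineReflection_eq_affineReflection_iff`) of
  `o s_{α_j} o⁻¹ = s_{gα_j, ⟨v,(gα_j)^∨⟩}` (Corollary 4.2) with the wall it equals, §1 deciding the sign.
* §3 PROPOSITION 1.21 (ii), FIRST HALF — ★★★ **`eq_of_linear_eq`**: `φ` IS INJECTIVE ON `Ω` (two elements of `Ω` with the same linear part differ by a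
  translation of `P(Φ)` fixing `A∘`, which is trivial by §1; root system).

BY NAME, nothing restated: rows g44-#1 (`extendedAffineWeylGroup`, `affineHom`, `affineReflection`, `exists_of_mem_extendedAffineWeylGroup`,
`constVAdd_mul_affineHom_mul_affineReflection_mul_inv`, `affineReflection_zero`, `linear_affineHom`, `affineHom_injective`, `weightLattice`), g44-#4
(`apply_zero_mem_weightLattice`, `constVAdd_mul_affineHom_apply_zero`), g44-#6 (`alcove`, `image_constVAdd_mul_affineHom_alcove`,
`eq_of_mem_alcove_of_mem_alcove`, `fundamentalAlcove_eq_alcove`), g44-#7 (`smul_sum_filter_isPos_mem_fundamentalAlcove`), g45-#1 (`wallReflection`,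
`coe_wallReflection_some ∕ none`), g45-#5 (`exists_perm_conj_wallReflection_eq`), g46-#1 (`affineReflection_eq_affineReflection_iff`), g36
(`isPos_of_highestRoot`, `flip_isPos_iff`); Mathlib `RootPairing.eq_zero_iff_forall_coroot'_eq_zero`, `RootPairing.Base.isPos_of_mem_support`,
`RootPairing.Base.IsPos.neg_iff_not`, `RootPairing.Equiv.weightHom_injective`.

## Scope caveats

Proposition 1.21 (i) (the explicit linear part `w_{Π_i} w_Π` of the element of `Ω` with translation part `ε_i`) is not derived here (row g45-#7 has the
existence and uniqueness of that element); the image `φ(Ω) ≤ W` is not described as a subgroup. Finite reduced crystallographic root systems over an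
ordered field; `η` with `hη` (highest coroot); §2's third case and §3 use `[P.IsRootSystem]` where stated.

## References

* [IwahoriMatsumoto1965] N. Iwahori, H. Matsumoto, Publ. Math. IHÉS 25 (1965) 5–48, §1.8 and Proposition 1.21 (p. 248).
* [Bourbaki2002LieGroups46] N. Bourbaki, *Lie Groups and Lie Algebras, Chapters 4–6*, Springer (2002), Ch. VI §2 no. 3 (cite-only).
* [Humphreys1990] J. E. Humphreys, *Reflection Groups and Coxeter Groups*, CUP (1990), §4.5 (p. 93).
-/

noncomputable section

open Module Set Function

namespace Literature.LinearAlgebra.RootSystem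

namespace Base

variable {ι K M N : Type*} [Field K] [LinearOrder K] [IsStrictOrderedRing K] [AddCommGroup M] [Module K M]
  [AddCommGroup N] [Module K N] [Fintype ι] [DecidableEq ι]
  {P : RootPairing ι K M N} [CharZero K] [P.IsCrystallographic] [P.IsReduced] (b : P.Base)

omit [LinearOrder K] [IsStrictOrderedRing K] [Fintype ι] [DecidableEq ι] [CharZero K] [P.IsCrystallographic] [P.IsReduced] in
/-- An automorphism of `P` commutes with `α ↦ -α` on indices: `g(-α_i) = -(gα_i)`. [folklore] -/
private theorem smul_reflectionPerm_self (g : P.Aut) (i : ι) :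
    g • P.reflectionPerm i i = P.reflectionPerm (g • i) (g • i) := by
  apply P.root.injective
  rw [smul_index_eq, smul_index_eq, RootPairing.Equiv.root_indexEquiv_eq_smul, RootPairing.root_reflectionPerm,
    RootPairing.root_reflectionPerm, RootPairing.reflection_apply_self, RootPairing.reflection_apply_self, smul_neg,
    RootPairing.Equiv.root_indexEquiv_eq_smul]

omit [LinearOrder K] [IsStrictOrderedRing K] [Fintype ι] [DecidableEq ι] [P.IsCrystallographic] [P.IsReduced] in
/-- `k∘_{-α} = -1` for a positive root `α` (the datum of `A∘` on a negative root). [cite: Humphreys1990, §4.3 ("A∘ := {λ ∈ V | 0 < (λ, α) < 1 for all α ∈ Φ⁺}")] -/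
private theorem ite_reflectionPerm_self_of_isPos [DecidablePred b.IsPos] {i : ι} (hi : b.IsPos i) :
    (if b.IsPos (P.reflectionPerm i i) then (0 : ℤ) else -1) = -1 := by
  letI := P.indexNeg
  have h : ¬ b.IsPos (P.reflectionPerm i i) := fun h' ↦ (RootPairing.Base.IsPos.neg_iff_not b i).mp h' hi
  rw [if_neg h]

/-! ## §1 The floor data of `oA∘ = A∘` -/

section Data

/-- ★★ **THE BOOKKEEPING IDENTITY OF AN ELEMENT OF `Ω`**: if `o = t(v)·g ∈ Ŵ_a` fixes `A∘` and `⟨v, α^∨⟩ = n_α`, then `k∘_α + n_{gα} = k∘_{gα}` for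
every root `α` (`o` carries `A∘ = alcove k∘` onto `alcove (α ↦ k∘_{g⁻¹α} + n_α)`, row g44-#6, which must be `alcove k∘` again).
[cite: IwahoriMatsumoto1965, §1.7 ("Ω = {σ ∈ DW ; σ𝔇∘ = 𝔇∘}")] [cite: Humphreys1990, §4.5 ("Ω is the subgroup of Ŵ_a stabilizing A∘")] -/
theorem floorData_smul_add_eq [Nonempty ι] [DecidablePred b.IsPos] {η : ι}
    (hη : ∀ k, P.coroot η - P.coroot k ∈ AddSubmonoid.closure (P.coroot '' (b.support : Set ι))) {o : M ≃ᵃ[K] M}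
    (hoA : o '' {x : M | ∀ i, b.IsPos i → 0 < P.coroot' i x ∧ P.coroot' i x < 1} =
      {x : M | ∀ i, b.IsPos i → 0 < P.coroot' i x ∧ P.coroot' i x < 1})
    {v : M} {g : P.Aut} (hog : o = AffineEquiv.constVAdd K M v * affineHom P g) {n : ι → ℤ} (hn : ∀ i, P.coroot' i v = n i) (j : ι) :
    (if b.IsPos j then (0 : ℤ) else -1) + n (g • j) = (if b.IsPos (g • j) then (0 : ℤ) else -1) := by
  obtain ⟨x₀, hx₀⟩ : {x : M | ∀ i, b.IsPos i → 0 < P.coroot' i x ∧ P.coroot' i x < 1}.Nonempty :=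
    ⟨_, smul_sum_filter_isPos_mem_fundamentalAlcove b hη⟩
  have hx₁ : x₀ ∈ alcove P (fun i ↦ if b.IsPos i then (0 : ℤ) else -1) := by rw [← fundamentalAlcove_eq_alcove b]; exact hx₀
  have h1 := image_constVAdd_mul_affineHom_alcove (P := P) (fun i ↦ if b.IsPos i then (0 : ℤ) else -1) g hn
  rw [← fundamentalAlcove_eq_alcove b, ← hog, hoA, fundamentalAlcove_eq_alcove b] at h1
  have h2 := congrFun (eq_of_mem_alcove_of_mem_alcove hx₁ (h1 ▸ hx₁)) (g • j)
  simp only [inv_smul_smul] at h2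
  rw [h2, add_comm]

end Data

/-! ## §2 Proposition 1.21 (ii): `φ(Ω)` permutes `{α_1, …, α_l, -α₀}` as `σ_o` permutes the nodes -/

section Permutes

variable [Nonempty ι] {η : ι} (hη : ∀ k, P.coroot η - P.coroot k ∈ AddSubmonoid.closure (P.coroot '' (b.support : Set ι)))
  {o : M ≃ᵃ[K] M} (ho : o ∈ extendedAffineWeylGroup P)
  (hoA : o '' {x : M | ∀ i, b.IsPos i → 0 < P.coroot' i x ∧ P.coroot' i x < 1} =
    {x : M | ∀ i, b.IsPos i → 0 < P.coroot' i x ∧ P.coroot' i x < 1})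
  {v : M} {g : P.Aut} (hog : o = AffineEquiv.constVAdd K M v * affineHom P g) {σ : Equiv.Perm (Option b.support)}
  (hσ : ∀ x, o * ((wallReflection b η x : affineWeylGroup P) : M ≃ᵃ[K] M) * o⁻¹ = ((wallReflection b η (σ x) : affineWeylGroup P) : M ≃ᵃ[K] M))

include hη ho hoA hog hσ

omit hη hoA in
omit [LinearOrder K] [IsStrictOrderedRing K] [Fintype ι] [DecidableEq ι] [CharZero K] [P.IsCrystallographic] [P.IsReduced] [Nonempty ι] in
/-- The conjugate of an old wall: `o s_{α_j} o⁻¹ = s_{gα_j, n_{gα_j}}` (Corollary 4.2), with `n = ⟨v, ·⟩` integral. [cite: Humphreys1990, §4.2 Corollary] -/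
private theorem conj_some_eq (j : b.support) :
    ∃ n : ι → ℤ, (∀ i, P.coroot' i v = n i) ∧ ((wallReflection b η (σ (some j)) : affineWeylGroup P) : M ≃ᵃ[K] M) =
      affineReflection P (g • (j : ι)) (n (g • (j : ι))) := by
  have hv : v ∈ weightLattice P := by
    have h0 := apply_zero_mem_weightLattice P ho
    rwa [hog, constVAdd_mul_affineHom_apply_zero] at h0
  choose n hn using hv
  refine ⟨n, hn, ?_⟩
  rw [← hσ (some j), coe_wallReflection_some, ← affineReflection_zero, hog, constVAdd_mul_affineHom_mul_affineReflection_mul_inv, hn, zero_add]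

omit hη hoA in
omit [LinearOrder K] [IsStrictOrderedRing K] [Fintype ι] [DecidableEq ι] [CharZero K] [P.IsCrystallographic] [P.IsReduced] [Nonempty ι] in
/-- The conjugate of the new wall: `o s_{α_η,1} o⁻¹ = s_{gα_η, 1 + n_{gα_η}}`. [cite: Humphreys1990, §4.2 Corollary] -/
private theorem conj_none_eq :
    ∃ n : ι → ℤ, (∀ i, P.coroot' i v = n i) ∧ ((wallReflection b η (σ none) : affineWeylGroup P) : M ≃ᵃ[K] M) =
      affineReflection P (g • η) ((1 + n (g • η) : ℤ) : K) := by
  have hv : v ∈ weightLattice P := by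
    have h0 := apply_zero_mem_weightLattice P ho
    rwa [hog, constVAdd_mul_affineHom_apply_zero] at h0
  choose n hn using hv
  refine ⟨n, hn, ?_⟩
  rw [← hσ none, coe_wallReflection_none, hog, constVAdd_mul_affineHom_mul_affineReflection_mul_inv, hn, Int.cast_add, Int.cast_one]

/-- ★★★ **`σ_o(j) = k` (OLD NODES) ⟹ `gα_j = α_k`**: the linear part `g = φ(o)` of `o ∈ Ω` maps the simple root of an old node to the simple root of its
image node. (`o s_{α_j} o⁻¹ = s_{gα_j, n_{gα_j}}` must be `s_{α_k}`; the other name `(-α_k, 0)` would give `n_{gα_j} = 0 = k∘_{-α_k} - k∘_{α_j} = -1`,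
absurd by §1.) [cite: IwahoriMatsumoto1965, Prop. 1.21 (ii) ("the set {α₁, …, α_l, −α₀} is stable under the subgroup W_Ω = φ(Ω) of W") and §1.8 ("induces a permutation of the set {w₀, w₁, …, w_l}")] -/
theorem smul_eq_of_perm_some_eq_some [DecidablePred b.IsPos] {j k : b.support} (hjk : σ (some j) = some k) : g • (j : ι) = k := by
  obtain ⟨n, hn, hconj⟩ := conj_some_eq b ho hog hσ j
  rw [hjk, coe_wallReflection_some, ← affineReflection_zero] at hconj
  have hdata := floorData_smul_add_eq b hη hoA hog hn (j : ι)
  rw [if_pos (RootPairing.Base.isPos_of_mem_support j.2), zero_add] at hdata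
  rcases (affineReflection_eq_affineReflection_iff P (k : ι) (g • (j : ι)) 0 (n (g • (j : ι)) : K)).mp hconj with
    ⟨h, -⟩ | ⟨h, hl⟩
  · exact h
  · -- `gα_j = -α_k` with `n_{gα_j} = 0`: contradicts `k∘_{gα_j} = -1`
    exfalso
    rw [neg_zero] at hl
    have hn0 : n (g • (j : ι)) = 0 := by exact_mod_cast hl
    rw [hn0, h, ite_reflectionPerm_self_of_isPos b (RootPairing.Base.isPos_of_mem_support k.2)] at hdata
    omega

/-- ★★★ **`σ_o(j) = 0` (AN OLD NODE GOES TO THE NEW NODE) ⟹ `gα_j = -α_η`** (on indices `g • j = s_η η`): `o s_{α_j} o⁻¹ = s_{gα_j, n_{gα_j}} = s_{α_η,1}`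
and the name `(α_η, 1)` would give `n_{gα_j} = 1 ≠ k∘_{α_η} - k∘_{α_j} = 0`. [cite: IwahoriMatsumoto1965, Prop. 1.21 (ii) and §1.8] -/
theorem smul_eq_of_perm_some_eq_none [DecidablePred b.IsPos] {j : b.support} (hj : σ (some j) = none) :
    g • (j : ι) = P.reflectionPerm η η := by
  obtain ⟨n, hn, hconj⟩ := conj_some_eq b ho hog hσ j
  rw [hj, coe_wallReflection_none] at hconj
  have hdata := floorData_smul_add_eq b hη hoA hog hn (j : ι)
  rw [if_pos (RootPairing.Base.isPos_of_mem_support j.2), zero_add] at hdata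
  have hηpos : b.IsPos η := by
    have h := isPos_of_highestRoot (P := P.flip) b.flip (θ := η) (by simpa only [RootPairing.flip_root, RootPairing.Base.flip_support] using hη)
    exact (flip_isPos_iff b η).mp h
  rcases (affineReflection_eq_affineReflection_iff P η (g • (j : ι)) 1 (n (g • (j : ι)) : K)).mp hconj with ⟨h, hl⟩ | ⟨h, -⟩
  · -- `gα_j = α_η` with `n = 1`: contradicts `k∘_{α_η} = 0`
    exfalso
    have hn1 : n (g • (j : ι)) = 1 := by exact_mod_cast hl
    rw [hn1, h, if_pos hηpos] at hdata
    omega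
  · exact h

/-- ★★★ **`σ_o(0) = k` (THE NEW NODE GOES TO AN OLD NODE) ⟹ `g(-α_η) = α_k`** (on indices `g • (s_η η) = k`): `o s_{α_η,1} o⁻¹ = s_{gα_η, 1 + n_{gα_η}} =
s_{α_k}`, and the name `(α_k, 0)` would give `k∘_{gα_η} = 0 ≠ k∘_{α_η} + n_{gα_η} = -1`. [cite: IwahoriMatsumoto1965, Prop. 1.21 (ii) ("the set {α₁, …, α_l, −α₀} is stable under … φ(Ω)") and (i) ("ρw₀ρ⁻¹ = w_i")] -/
theorem smul_eq_of_perm_none_eq_some [DecidablePred b.IsPos] {k : b.support} (hk : σ none = some k) :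
    g • P.reflectionPerm η η = (k : ι) := by
  obtain ⟨n, hn, hconj⟩ := conj_none_eq b ho hog hσ
  rw [hk, coe_wallReflection_some, ← affineReflection_zero] at hconj
  have hdata := floorData_smul_add_eq b hη hoA hog hn η
  have hηpos : b.IsPos η := by
    have h := isPos_of_highestRoot (P := P.flip) b.flip (θ := η) (by simpa only [RootPairing.flip_root, RootPairing.Base.flip_support] using hη)
    exact (flip_isPos_iff b η).mp h
  rw [if_pos hηpos, zero_add] at hdata
  rcases (affineReflection_eq_affineReflection_iff P (k : ι) (g • η) 0 ((1 + n (g • η) : ℤ) : K)).mp hconj with ⟨h, hl⟩ | ⟨h, -⟩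
  · -- `gα_η = α_k` with `1 + n = 0`: contradicts `k∘_{α_k} = 0`
    exfalso
    have hn1 : n (g • η) = -1 := by
      have : (1 + n (g • η) : ℤ) = 0 := by exact_mod_cast hl
      omega
    rw [hn1, h, if_pos (RootPairing.Base.isPos_of_mem_support k.2)] at hdata
    omega
  · -- `gα_η = -α_k`, i.e. `g(-α_η) = α_k`
    letI := P.indexNeg
    rw [smul_reflectionPerm_self, h]
    exact neg_neg (k : ι)

/-- ★★ **`σ_o(0) = 0` ⟹ `gα_η = α_η`** (then in fact `o = 1`, row g45-#7 `eq_one_of_perm_none`; here only the linear statement): the name `(-α_η, -1)` of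
`s_{α_η,1}` would give `n_{gα_η} = -2 ≠ k∘_{-α_η} - k∘_{α_η} = -1`. [cite: IwahoriMatsumoto1965, Prop. 1.21 (ii) and §1.8] -/
theorem smul_eq_of_perm_none_eq_none [DecidablePred b.IsPos] (h0 : σ none = none) : g • η = η := by
  obtain ⟨n, hn, hconj⟩ := conj_none_eq b ho hog hσ
  rw [h0, coe_wallReflection_none] at hconj
  have hdata := floorData_smul_add_eq b hη hoA hog hn η
  have hηpos : b.IsPos η := by
    have h := isPos_of_highestRoot (P := P.flip) b.flip (θ := η) (by simpa only [RootPairing.flip_root, RootPairing.Base.flip_support] using hη)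
    exact (flip_isPos_iff b η).mp h
  rw [if_pos hηpos, zero_add] at hdata
  rcases (affineReflection_eq_affineReflection_iff P η (g • η) 1 ((1 + n (g • η) : ℤ) : K)).mp hconj with ⟨h, -⟩ | ⟨h, hl⟩
  · exact h
  · exfalso
    have hn2 : n (g • η) = -2 := by
      have : (1 + n (g • η) : ℤ) = -1 := by exact_mod_cast hl
      omega
    rw [hn2, h, ite_reflectionPerm_self_of_isPos b hηpos] at hdata
    omega

/-- ★★ **«THE SET `{α₁, …, α_l, -α₀}` IS STABLE UNDER `φ(Ω)`», OLD ROOTS**: `gα_j ∈ Δ ∪ {-α_η}` for `j ∈ Δ`. [cite: IwahoriMatsumoto1965, Prop. 1.21 (ii) ("the set {α₁, …, α_l, −α₀} is stable under the subgroup W_Ω = φ(Ω) of W")] -/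
theorem smul_mem_of_mem_support [DecidablePred b.IsPos] (j : b.support) :
    g • (j : ι) ∈ insert (P.reflectionPerm η η) (b.support : Set ι) := by
  rcases hx : σ (some j) with _ | k
  · exact mem_insert_iff.mpr (Or.inl (smul_eq_of_perm_some_eq_none b hη ho hoA hog hσ hx))
  · exact mem_insert_of_mem _ (by rw [smul_eq_of_perm_some_eq_some b hη ho hoA hog hσ hx]; exact k.2)

/-- ★★ **«THE SET `{α₁, …, α_l, -α₀}` IS STABLE UNDER `φ(Ω)`», THE ROOT `-α₀`**: `g(-α_η) ∈ Δ ∪ {-α_η}`. [cite: IwahoriMatsumoto1965, Prop. 1.21 (ii)] -/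
theorem smul_reflectionPerm_mem [DecidablePred b.IsPos] :
    g • P.reflectionPerm η η ∈ insert (P.reflectionPerm η η) (b.support : Set ι) := by
  rcases hx : σ none with _ | k
  · refine mem_insert_iff.mpr (Or.inl ?_)
    rw [smul_reflectionPerm_self, smul_eq_of_perm_none_eq_none b hη ho hoA hog hσ hx]
  · exact mem_insert_of_mem _ (by rw [smul_eq_of_perm_none_eq_some b hη ho hoA hog hσ hx]; exact k.2)

end Permutes

/-! ## §3 Proposition 1.21 (ii): `φ` is injective on `Ω` -/

section Injective

/-- ★★★ **«`φ : DW → W` IS INJECTIVE ON `Ω`»**: two elements of `Ŵ_a` fixing `A∘` with the same linear part are equal — they differ by a translation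
`t(u)`, `u ∈ P(Φ)`, fixing `A∘`, and `t(u)A∘ = alcove (k∘ + ⟨u, ·⟩) = A∘` forces every level `⟨u, α^∨⟩` to vanish, so `u = 0` (root system).
[cite: IwahoriMatsumoto1965, Prop. 1.21 (ii) ("φ is injective on Ω") and §1.8 ("This homomorphism is injective")] [cite: Humphreys1990, §4.5 ("Ω ≅ Ŵ_a/W_a ≅ L̂/L")] -/
theorem eq_of_linear_eq [Nonempty ι] [P.IsRootSystem] [DecidablePred b.IsPos] {η : ι}
    (hη : ∀ k, P.coroot η - P.coroot k ∈ AddSubmonoid.closure (P.coroot '' (b.support : Set ι))) {o o' : M ≃ᵃ[K] M}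
    (ho : o ∈ extendedAffineWeylGroup P) (ho' : o' ∈ extendedAffineWeylGroup P)
    (hoA : o '' {x : M | ∀ i, b.IsPos i → 0 < P.coroot' i x ∧ P.coroot' i x < 1} =
      {x : M | ∀ i, b.IsPos i → 0 < P.coroot' i x ∧ P.coroot' i x < 1})
    (ho'A : o' '' {x : M | ∀ i, b.IsPos i → 0 < P.coroot' i x ∧ P.coroot' i x < 1} =
      {x : M | ∀ i, b.IsPos i → 0 < P.coroot' i x ∧ P.coroot' i x < 1})
    (hlin : o.linear = o'.linear) : o = o' := by
  obtain ⟨v, hv, g, -, rfl⟩ := exists_of_mem_extendedAffineWeylGroup P ho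
  obtain ⟨v', hv', g', -, rfl⟩ := exists_of_mem_extendedAffineWeylGroup P ho'
  -- the linear parts are `g`, `g'`
  have hgg : g = g' := by
    apply affineHom_injective P
    refine AffineEquiv.ext fun x ↦ ?_
    have h := LinearEquiv.congr_fun hlin x
    rw [← AffineEquiv.linearHom_apply, ← AffineEquiv.linearHom_apply, map_mul, map_mul, AffineEquiv.linearHom_apply,
      AffineEquiv.linearHom_apply, AffineEquiv.linearHom_apply, AffineEquiv.linear_constVAdd, AffineEquiv.linear_constVAdd] at h
    exact h
  subst hgg
  -- `o' o⁻¹ = t(v' - v)` fixes `A∘`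
  set u : M := v' + -v with hu
  have hfix : AffineEquiv.constVAdd K M u '' {x : M | ∀ i, b.IsPos i → 0 < P.coroot' i x ∧ P.coroot' i x < 1} =
      {x : M | ∀ i, b.IsPos i → 0 < P.coroot' i x ∧ P.coroot' i x < 1} := by
    have h1 : (AffineEquiv.constVAdd K M v' * affineHom P g) * (AffineEquiv.constVAdd K M v * affineHom P g)⁻¹ =
        AffineEquiv.constVAdd K M u := by
      rw [mul_inv_rev, ← mul_assoc, mul_assoc (AffineEquiv.constVAdd K M v'), mul_inv_cancel, mul_one, AffineEquiv.inv_def,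
        AffineEquiv.constVAdd_symm, constVAdd_mul_constVAdd, hu]
    rw [← h1, AffineEquiv.coe_mul, image_comp, (inv_mem_stabilizer b ho hoA).2, ho'A]
  -- the levels of `u` vanish
  choose n hn using (weightLattice P).add_mem hv' ((weightLattice P).neg_mem hv)
  have hdata := floorData_smul_add_eq b hη hfix (g := 1) (by rw [map_one, mul_one]) hn
  have hu0 : u = 0 := by
    refine P.eq_zero_iff_forall_coroot'_eq_zero.mpr fun i ↦ ?_
    have h := hdata i
    rw [one_smul, add_eq_left] at h
    rw [hn i, h, Int.cast_zero]
  have hvv : v' = v := by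
    rw [hu, add_neg_eq_zero] at hu0
    exact hu0
  rw [hvv]

end Injective

end Base

end Literature.LinearAlgebra.RootSystem
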